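import Literature.NumberTheory.EllipticCurves.HeegnerPointsOfConductor
import Literature.NumberTheory.EllipticCurves.SelmerTorsionInclusion
import HarnessLib

/-!
# Route `GenusKolyvaginAtTwo`, crux L_T `PowDvdShaCardAtTwoRT` (stmt-BirchSwinnertonDyer-23242), LINE 18/19 stub 3a⁗, step (b),
# input I1: McCALLUM'S LEMMA 4.6 — the change of level of Kolyvagin's classes, `ι(c_{M′}(n)) = p^{M−M′} c_M(n)`

Seat `bsd-line-gk2-p2` g16 (PROVER seat 2/3, cell `bsd-f1-sign2`), `--supports 23242 --as helper`. THEOREMS ONLY (no definition,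
no named fact, no `sorry`). BSD is not proved by any of this; neither is the crux.

McCallum 1991 (*Kolyvagin's work on Shafarevich–Tate groups*, LMS LN 153), Lemma 4.6 (held text
`book:editornd-l-functions-arithmetic` p0283), verbatim: «Suppose `n ∈ S_r(M)` and `p^{M′} | P_n` … » — and, as USED in §5
(p0284 «By Lemma 4.6, `p^{M′} d_{M+M′}(n) = d_M(n)`»; p0285 «By Lemma 4.6, it suffices to prove the proposition for large enough
`M`»): for `M′ ≤ M` the class `c_{M′}(n) ∈ H¹(K, E[p^{M′}])`, moved into `H¹(K, E[p^M])` along `E[p^{M′}] ↪ E[p^M]`, equals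
`p^{M−M′} c_M(n)`. Input I1 of the memo `Cruxes/PowDvdShaCardAtTwoRT/Lines/plus-descent-step-b-prop52.md` («multi-level
compatibility: NOT typed»): every multi-depth argument of the structure theorem compares classes of ONE derived point `P(n)` at
SEVERAL levels (`c_{M_r+1}(n)`, `c_{M_{r−1}}(n)`, `c_M(n)`) inside the single ambient group `H¹(·, E[p^M])`; in the weak swap loop
(`…RTPrimeSwappingWeak`, `exists_avoiding_of_weakSwapOracle_pow`) this is the hypothesis «`γ S = p^{e−1} · cls S`» with
`cls S = ι c_{M_{r−1}}(n_S) = p^{M−M_{r−1}} c_M(n_S)` and `γ S = ι c_{M_r+1}(n_S)`.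

PROOF (cocycle level, generic). McCallum's cocycle at level `N = d·m` with root `Q` (`N Q = P`) is `g ↦ gQ − Q − (g−1)P/N`; at
level `d` one may take the root `m Q` (`d (mQ) = P`), and `(g−1)P/d = m · (g−1)P/N` by uniqueness of division in the admissible
subgroup `A` (`[d]` is injective on `A` because `[N]` is). Hence the level-`d` cocycle, viewed in `M[N] ⊇ M[d]`, is `m` times the
level-`N` cocycle — an identity of cocycles, not only of classes.

* §1 generic (`KolyvaginCocycle.cls`, any topological group `G`, discrete `G`-module, admissible `A`, levels `d ∣ N`):
  `isAdmissible_of_dvd`, `mem_invPoints_of_dvd`, **`map_inclusion_cls_eq_zsmul`**;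
* §2 curves (`kolyvaginClass W`, `torsionH1OfDvd`): **`torsionH1OfDvd_kolyvaginClass_eq_zsmul`**;
* §3 Heegner data (`KolyvaginHeegnerData.kolyvaginClass hp M`): **`torsionH1OfDvd_kolyvaginClass_pow`** —
  `ι_{M′ ≤ M} (c_{M′}(n)) = p^{M−M′} • c_M(n)` under admissibility at level `M` (which implies it at level `M′`).

References: [McCallumLMS1991] §4 Lemma 4.6 (and its uses on pp. 306–308); [GrossLMS1991] §4 (4.4)–(4.6).
-/

set_option autoImplicit false
-- `Summit.<P>.<Sub>` repeats `BirchSwinnertonDyer` by the tree's layout convention (D-0017)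
set_option linter.dupNamespace false

noncomputable section

open scoped Classical

universe u

namespace Summit.BirchSwinnertonDyer.BirchSwinnertonDyer.Theorems.GenusExact.PlusDescent

open WeierstrassCurve
open Literature.NumberTheory.EllipticCurves Literature.NumberTheory.GaloisRepresentations
open Literature.NumberTheory.EllipticCurves.KolyvaginCocycle

/-! ## §1 Generic: McCallum's cocycle at two levels `d ∣ N` -/

section Generic

variable {G : Type u} [Group G] [TopologicalSpace G] [IsTopologicalGroup G]
variable {M : Type u} [AddCommGroup M] [DistribMulAction G M] [TopologicalSpace M] [DiscreteTopology M]
variable {A : AddSubgroup M} {d N : ℤ}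

omit [TopologicalSpace G] [IsTopologicalGroup G] [TopologicalSpace M] [DiscreteTopology M] in
/-- Admissibility descends along divisibility of the level: if `[N]` is injective on the `G`-stable subgroup `A` and `d ∣ N`,
so is `[d]`. [folklore] -/
theorem isAdmissible_of_dvd (h : d ∣ N) (hA : IsAdmissible G A N) : IsAdmissible G A d := by
  obtain ⟨m, rfl⟩ := h
  refine ⟨hA.smul_mem, fun a ha hda ↦ hA.eq_zero_of_zsmul ha ?_⟩
  rw [mul_comm, mul_smul, hda, smul_zero]

omit [TopologicalSpace G] [IsTopologicalGroup G] [TopologicalSpace M] [DiscreteTopology M] in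
/-- `invPoints` grows as the level is divided: `(g−1)P ∈ N·A ⊆ d·A` for `d ∣ N`. [folklore] -/
theorem mem_invPoints_of_dvd (h : d ∣ N) {P : M} (hP : P ∈ invPoints G A N) : P ∈ invPoints G A d := by
  obtain ⟨m, rfl⟩ := h
  refine ⟨hP.1, fun g ↦ ?_⟩
  obtain ⟨R, hR, hRe⟩ := hP.2 g
  exact ⟨m • R, A.zsmul_mem hR m, by rw [← mul_smul, hRe]⟩

omit [TopologicalSpace G] [IsTopologicalGroup G] [TopologicalSpace M] [DiscreteTopology M] in
/-- The root at level `d` is `m` times the root at level `N = d·m` (uniqueness of division in `A`). [cite: McCallumLMS1991, §4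
Lemma 4.1 («the uniqueness from (5)»), Lemma 4.6] -/
theorem rootIn_eq_zsmul_rootIn {m : ℤ} (hm : N = d * m) (hA : IsAdmissible G A N) {x : M} (hx : ∃ R ∈ A, N • R = x) :
    rootIn A d x = m • rootIn A N x := by
  have hAd : IsAdmissible G A d := isAdmissible_of_dvd ⟨m, hm⟩ hA
  refine rootIn_eq hAd.eq_zero_of_zsmul (A.zsmul_mem (rootIn_spec hx).1 m) ?_
  rw [← mul_smul, ← hm, (rootIn_spec hx).2]

/-- **McCallum's Lemma 4.6 at the level of classes, generic form.** For levels `N = d·m`, an admissible `A` (for `N`, hence for `d`),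
`P ∈ invPoints` (for `N`, hence for `d`), a root `Q` with `N·Q = P` (so `d·(mQ) = P`): the image of the level-`d` class
`c_d(P; mQ) ∈ H¹(G, M[d])` under the change of level `H¹(G, M[d]) → H¹(G, M[N])` (the compatible pair `(id, M[d] ↪ M[N])`) is
`m · c_N(P; Q)`. The two cocycles agree VALUE BY VALUE in `M`: `g(mQ) − mQ − (g−1)P/d = m·(gQ − Q − (g−1)P/N)`.
[cite: McCallumLMS1991, §4 Lemma 4.6] -/
theorem map_inclusion_cls_eq_zsmul {m : ℤ} (hm : N = d * m)
    (hle : AddSubgroup.torsionBy M d ≤ AddSubgroup.torsionBy M N)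
    (hAN : IsAdmissible G A N) (hAd : IsAdmissible G A d) (hcont : ∀ x : M, Continuous fun g : G ↦ g • x)
    {P : M} (hPN : P ∈ invPoints G A N) (hPd : P ∈ invPoints G A d)
    {Q : M} (hQ : N • Q = P) (hQ' : d • (m • Q) = P) :
    ContinuousCohomology.map (ContinuousMonoidHom.id G)
        (resHomOfEquivariant (ContinuousMonoidHom.id G) (AddSubgroup.inclusion hle) (fun _ _ ↦ rfl)) 1
        (cls hAd hcont hPd hQ') = m • cls hAN hcont hPN hQ := by
  unfold cls
  rw [map_oneCocycleClass, ← oneCocycleClassₗ_apply, ← oneCocycleClassₗ_apply, ← map_zsmul, oneCocycleClassₗ_apply,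
    oneCocycleClassₗ_apply]
  refine oneCocycleClass_congr_val fun g ↦ ?_
  change ((AddSubgroup.inclusion hle ((cocycle hAd hcont hPd hQ').1 g) : AddSubgroup.torsionBy M N) : M) =
    m • (g • Q - Q - rootIn A N (g • P - P))
  rw [AddSubgroup.coe_inclusion, coe_cocycle_apply, rootIn_eq_zsmul_rootIn hm hAN (hPN.2 g), smul_zsmul_comm, zsmul_sub,
    zsmul_sub]

end Generic

/-! ## §2 Curves: `torsionH1OfDvd` of Kolyvagin's class -/

section Curve

variable {K : Type u} [Field K] (W : WeierstrassCurve K)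

/-- **McCallum's Lemma 4.6 for `E`** (change of level of Kolyvagin's class of a point `P ∈ E(K̄)` relative to an admissible
`A = E(K_n)`): for levels `N = d·m`, `torsionH1OfDvd (c_d(P)) = m · c_N(P)` in `H¹(K, E[N])` — independent of the chosen roots.
[cite: McCallumLMS1991, §4 Lemma 4.6] -/
theorem torsionH1OfDvd_kolyvaginClass_eq_zsmul {d N : ℤ} (m : ℤ) (hm : N = d * m)
    (hdivN : ∀ P : geomPoints W, ∃ Q : geomPoints W, N • Q = P) (hdivd : ∀ P : geomPoints W, ∃ Q : geomPoints W, d • Q = P)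
    {A : AddSubgroup (geomPoints W)} (hAN : IsAdmissible (Field.absoluteGaloisGroup K) A N)
    (hAd : IsAdmissible (Field.absoluteGaloisGroup K) A d) (P : geomPoints W)
    (hPN : P ∈ invPoints (Field.absoluteGaloisGroup K) A N) (hPd : P ∈ invPoints (Field.absoluteGaloisGroup K) A d) :
    torsionH1OfDvd W (⟨m, hm⟩ : d ∣ N) (kolyvaginClass W d hdivd hAd P hPd) = m • kolyvaginClass W N hdivN hAN P hPN := by
  obtain ⟨Q, hQ⟩ := hdivN P
  have hQ' : d • (m • Q) = P := by rw [← mul_smul, ← hm, hQ]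
  rw [kolyvaginClass_eq_cls hAN hPN hQ, kolyvaginClass_eq_cls hAd hPd hQ']
  exact map_inclusion_cls_eq_zsmul hm (geomTorsion_le_of_dvd W ⟨m, hm⟩) hAN hAd (continuous_smul_geomPoints W) hPN hPd hQ hQ'

end Curve

/-! ## §3 Heegner data: `ι(c_{M′}(n)) = p^{M−M′} · c_M(n)` -/

section Heegner

open NumberField Literature.NumberTheory.EllipticCurves.ModularForms

variable {K : Type} [Field K] [NumberField K] {W : WeierstrassCurve ℚ} {Nc : ℕ} [NeZero Nc]
variable {Dt : ModularParametrizationData W Nc} {β : ℤ} {ι : K →+* ℂ} {n : ℕ}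

/-- `p^{M′} ∣ p^M` as integers for `M′ ≤ M` (the divisibility fed to `torsionH1OfDvd`). [folklore] -/
theorem natCast_pow_dvd_natCast_pow {p M' M : ℕ} (h : M' ≤ M) : ((p ^ M' : ℕ) : ℤ) ∣ ((p ^ M : ℕ) : ℤ) := by
  exact_mod_cast pow_dvd_pow p h

/-- **McCALLUM'S LEMMA 4.6 for the Kolyvagin classes of a Heegner datum** (`c_M(n) = d.kolyvaginClass hp M`, all levels from the ONE
derived point `P(n)`): for `M′ ≤ M`, under the standing admissibility inputs AT LEVEL `M` (Gross Lemma 4.3: `E(K[n])` has no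
`p^M`-torsion and is `Γ_K`-stable; Prop. 3.6: `[P(n)]` is `Γ_K`-invariant mod `p^M` — both then hold at level `M′`),
`torsionH1OfDvd (c_{M′}(n)) = p^{M−M′} · c_M(n)` in `H¹(K, E[p^M])`. In particular `c_{M′}(n)` and `p^{M−M′} c_M(n)` have the same
image in `H¹(K, E)` and the same local behaviour, and `ι c_{M_r+1}(n) = p^{M_{r−1}−M_r−1} · ι c_{M_{r−1}}(n)` (the «detected class is the
socle of the ladder class» hypothesis of `exists_avoiding_of_weakSwapOracle_pow`). [cite: McCallumLMS1991, §4 Lemma 4.6] -/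
theorem torsionH1OfDvd_kolyvaginClass_pow (d : KolyvaginHeegnerData Dt β ι n) {p : ℕ} (hp : p.Prime) {M' M : ℕ}
    (hM : M' ≤ M)
    (hA : IsAdmissible (Field.absoluteGaloisGroup K) d.pointsSubgroup ((p ^ M : ℕ) : ℤ))
    (hP : d.toGeomPoints d.derivedPoint ∈
      invPoints (Field.absoluteGaloisGroup K) d.pointsSubgroup ((p ^ M : ℕ) : ℤ)) :
    torsionH1OfDvd (W.baseChange K) (natCast_pow_dvd_natCast_pow (p := p) hM) (d.kolyvaginClass hp M') =
      ((p ^ (M - M') : ℕ) : ℤ) • d.kolyvaginClass hp M := by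
  have hdvd : ((p ^ M' : ℕ) : ℤ) ∣ ((p ^ M : ℕ) : ℤ) := natCast_pow_dvd_natCast_pow (p := p) hM
  have hm : ((p ^ M : ℕ) : ℤ) = ((p ^ M' : ℕ) : ℤ) * ((p ^ (M - M') : ℕ) : ℤ) := by
    rw [← Nat.cast_mul, ← pow_add, Nat.add_sub_cancel' hM]
  have hA' : IsAdmissible (Field.absoluteGaloisGroup K) d.pointsSubgroup ((p ^ M' : ℕ) : ℤ) := isAdmissible_of_dvd hdvd hA
  have hP' : d.toGeomPoints d.derivedPoint ∈
      invPoints (Field.absoluteGaloisGroup K) d.pointsSubgroup ((p ^ M' : ℕ) : ℤ) := mem_invPoints_of_dvd hdvd hP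
  rw [d.kolyvaginClass_of_admissible hp M hA hP, d.kolyvaginClass_of_admissible hp M' hA' hP']
  exact torsionH1OfDvd_kolyvaginClass_eq_zsmul (W.baseChange K) _ hm _ _ hA hA' _ hP hP'

/-- **Corollary (same image in `H¹(K, E)`):** `d_{M′}(n) = p^{M−M′} d_M(n)` — McCallum's printed form of Lemma 4.6 as used on
p. 306 («`p^{M′} d_{M+M′}(n) = d_M(n)`»): the images of `c_{M′}(n)` and of `p^{M−M′} c_M(n)` under `H¹(K, E[·]) → H¹(K, E)` agree.
[cite: McCallumLMS1991, §4 Lemma 4.6, Prop. 4.7 (proof)] -/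
theorem torsionH1ToH1_kolyvaginClass_eq_pow_smul (d : KolyvaginHeegnerData Dt β ι n) {p : ℕ} (hp : p.Prime) {M' M : ℕ}
    (hM : M' ≤ M)
    (hA : IsAdmissible (Field.absoluteGaloisGroup K) d.pointsSubgroup ((p ^ M : ℕ) : ℤ))
    (hP : d.toGeomPoints d.derivedPoint ∈
      invPoints (Field.absoluteGaloisGroup K) d.pointsSubgroup ((p ^ M : ℕ) : ℤ)) :
    torsionH1ToH1 (W.baseChange K) ((p ^ M' : ℕ) : ℤ) (d.kolyvaginClass hp M') =
      ((p ^ (M - M') : ℕ) : ℤ) • torsionH1ToH1 (W.baseChange K) ((p ^ M : ℕ) : ℤ) (d.kolyvaginClass hp M) := by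
  rw [← torsionH1ToH1_torsionH1OfDvd (W.baseChange K) (natCast_pow_dvd_natCast_pow (p := p) hM),
    torsionH1OfDvd_kolyvaginClass_pow d hp hM hA hP, map_zsmul]

end Heegner

end Summit.BirchSwinnertonDyer.BirchSwinnertonDyer.Theorems.GenusExact.PlusDescent

end
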